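/-
Copyright: lit-balaban cell (HOME `run/shared/lean/pub/lit-balaban/`), Phase-2 proof seat p12 (gen 7).  The proofs reproduce the
printed arguments; nothing is claimed beyond what the kernel checks below.
-/
import Literature.MathematicalPhysics.QuantumFieldTheory.DybalskiStottmeisterTanimoto2024.DST24LinearConstraint
import Literature.MathematicalPhysics.QuantumFieldTheory.Federbush1986.PureAveragesSU2Lemma12

/-!
# `DybalskiStottmeisterTanimoto2024.DST24TangentSpace` — [DybalskiStottmeisterTanimoto2024] **§3.1–§3.2 «Tangent space of the
# constraint manifold»** PROVED: the maps `R_{A⃗}`, `R_{A⃗}^*`, `R̄_{A⃗}`, the Lie derivative of `c′` along the flows `e^{tX}U`,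
# Theorem (tangent-space-thm) `𝓛_X c′(U′)(y) = 0 ⇔ Σ_{x∈B(y)} R(x)X⃗(x) = 0`, and its identification with the intrinsic tangency
# `𝓛_X 𝒞 = 0` ((3.2), `DST24Setting.IsTangent`) used in the statement of Theorem 1

statement-level skeleton of published theorems with citation tags; proofs where landed; nothing here is a claim about
the Yang–Mills mass gap

W. Dybalski, A. Stottmeister, Y. Tanimoto, *The Bałaban variational problem in the non-linear sigma model*, Rev. Math. Phys.
**36** (2024), arXiv:2403.09800; source held `paper:arxiv-2403.09800` (§3.1–3.2 = tex chunks p0008–p0009).  Unit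
`lit-balaban-p12` (gen 7); carrier and dictionary in `DST24Setting`: `SU(2)` = unit quaternions, `U′(x) = A₀ + iA⃗·σ⃗ ↔ q = A₀ − A⃗`
(`A⃗ = vecOf q = −Im q ∈ Im ℍ ≅ ℝ³`, coordinates w.r.t. `(i, j, k)` = coordinates w.r.t. `σ⃗`), the print's Lie algebra element
`iX = iX⃗·σ⃗` ↔ the imaginary quaternion `ξ` generating the flow `e^{tξ}U` of `DST24Setting.flow`, with `X⃗ = vecOf ξ`; the cross
product of `ℝ³` is `A⃗ × v⃗ = Im(A v)` on `Im ℍ`.  The abstract Lemma (kernel-lemma) is `DST24KernelLemma`.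

WHAT IS PRINTED (§3.1–3.2) AND PROVED HERE.
* (def-R) «`R_{A⃗}(x)v⃗ = δA₀(x)v⃗ + A⃗(x) × v⃗`», (R-star) «`R_{A⃗}^*(x)v⃗ = δA₀(x)v⃗ − A⃗(x) × v⃗`» (obtained «using
  `w⃗·(A⃗ × v⃗) = −(A⃗ × w⃗)·v⃗`»), and «their inverses, which exist for `A₀ ≠ 0`», (3.1′) «`R̄_{A⃗}v⃗ = (1/cos a)P_n̂ v⃗ + cos a P_n̂^⊥v⃗
  − sin a (n̂ × P_n̂^⊥ v⃗)`» — `R`, `Rstar`, `inner_R_left` (`R*` IS the adjoint), `Rbar` with `R_Rbar`/`Rbar_R` (two-sided inverse for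
  `A₀ ≠ 0`, in the polynomial form `R̄ = A₀⁻¹(1 − A₀[A⃗×] + [A⃗×]²)`, which is the printed axis–angle formula expanded), `Requiv`.
* (flow)/(Lie-derivative) «`γ_t(U) = e^{itX}U`», «`(𝓛_X F)(U₀) = d/dt F(e^{itX}U₀)|_{t=0}`» (§3.1) are `DST24Setting.flow/lieDeriv`;
  here: `hasDerivAt_flow_val` (`d/dt e^{tξ}q = ξ e^{tξ} q`), `hasDerivAt_C0_flow`, `flow_Uprime` (`(e^{tX}U)′ = e^{tX}U′`).
* (tangent-equation) «`𝓛_X c′(U′)(y) = i Σ_{x∈B(y)} (X(x)U′(x) + U′(x)*X(x))`» — `hasDerivAt_cPrime_flow`, `lieDeriv_cPrime`; (3.3) «`=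
  Σ_x 2(A₀X_j − A_kX_{j′}ε_{j′kj})σ_j`», i.e. `XU′ + U′*X = 2(R X⃗)·σ⃗` — `coe_mul_add_star_mul` with `im_coe_mul_eq_neg_R`
  (`Im(ξq) = −R_{A⃗}X⃗` as imaginary quaternions, `δ = 1`).
* Theorem (tangent-space-thm) «Suppose that `U ∈ 𝔘_ε(Ω)` satisfies the constraint.  Then for any `iX ∈ 𝔤₀^{⊕n²}` the property
  `𝓛_X c′(U′)(y) = 0` is equivalent to (3.1) `Σ_{x∈B(y)} R(x)X⃗(x) = 0`» — `tangent_space_thm`.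
* (3.2)/(vectors) «Such `X` can be characterized by the conditions `(𝓛_X C_j)(U₀) = d/dt C_j(e^{itX}U₀)|_{t=0} = 0`» with `C = 𝒞 − V`
  the actual constraint of Theorem 1: the derivative of the polar part `𝒞 = 𝒞₀|𝒞₀|⁻¹` along the flow is `ρ⁻¹ Im(𝒞̇₀(U′)) V(y)`
  (`hasDerivAt_normalize`, `hasDerivAt_avg_flow`), hence `IsTangent X U ⇔ Im Σ_x ξ(x)U′(x) = 0 ∀y ⇔ 𝓛_X c′(U′) = 0 ⇔ (3.1)` —
  `isTangent_iff_im_eq_zero`, `isTangent_iff` (the form in which §3.3 uses the tangent space).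
-/

namespace Literature.MathematicalPhysics.QuantumFieldTheory.DybalskiStottmeisterTanimoto2024.DST24TangentSpace

open scoped Quaternion RealInnerProductSpace BigOperators Topology
open Literature.MathematicalPhysics.QuantumFieldTheory.Federbush1986
open Literature.MathematicalPhysics.QuantumFieldTheory.DybalskiStottmeisterTanimoto2024.DST24Setting
open Literature.MathematicalPhysics.QuantumFieldTheory.DybalskiStottmeisterTanimoto2024.DST24Configurations
open Literature.MathematicalPhysics.QuantumFieldTheory.DybalskiStottmeisterTanimoto2024.DST24LinearConstraint

noncomputable section

variable {L n₁ : ℕ}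

/-! ## Tools on `ℍ`: `Im` as a continuous linear map -/

/-- `Im : ℍ → ℍ` as a continuous `ℝ`-linear map (used to differentiate `c′ = 2i Im 𝒞₀` along flows and to push `Im` through
block sums). [cite: DybalskiStottmeisterTanimoto2024, §3.2 proof of Theorem (tangent-space-thm) («we compute `𝓛_X c′(U′)(y)`»)] -/
def imL : ℍ →L[ℝ] ℍ :=
  { toFun := Quaternion.im
    map_add' := fun p q => by simp
    map_smul' := fun r q => by simp [Quaternion.im_smul]
    cont := Quaternion.continuous_im }

/-- `imL q = Im q`. [cite: DybalskiStottmeisterTanimoto2024, §3.2 proof of Theorem (tangent-space-thm)] -/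
@[simp] theorem imL_apply (q : ℍ) : imL q = q.im := rfl

/-- `‖A‖² = A_1² + A_2² + A_3²` for `A ∈ Im ℍ`. [cite: DybalskiStottmeisterTanimoto2024, §1.1 (Pauli-matrices-decomposition) («`|A⃗|`»)] -/
theorem norm_sq_su2 (A : su2) : ‖A‖ ^ 2 = (A : ℍ).imI ^ 2 + (A : ℍ).imJ ^ 2 + (A : ℍ).imK ^ 2 := by
  rw [← su2.norm_coe, sq, ← Quaternion.normSq_eq_norm_mul_self, Quaternion.normSq_def', su2.re_coe A]
  ring

/-! ## (def-R), (R-star): `R_{A⃗} v⃗ = δA₀ v⃗ + A⃗ × v⃗`, its adjoint and its inverse -/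

/-- `v⃗ ↦ A⃗ × v⃗` on `Im ℍ ≅ ℝ³`: for imaginary quaternions `A⃗ × v⃗ = Im(A v)` (the `(i,j,k)`-coordinates of `Im(Av)` are
`(A_2v_3 − A_3v_2, …)`). [cite: DybalskiStottmeisterTanimoto2024, §3.2 (def-R) («`A⃗(x) × v⃗`»)] -/
def crossLin (A : su2) : su2 →ₗ[ℝ] su2 :=
  LinearMap.codRestrict su2 ((((imL : ℍ →L[ℝ] ℍ) : ℍ →ₗ[ℝ] ℍ).comp (LinearMap.mulLeft ℝ (A : ℍ))).domRestrict su2)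
    fun v => su2.im_mem ((A : ℍ) * v)

/-- `A⃗ × v⃗ = Im(A v)`. [cite: DybalskiStottmeisterTanimoto2024, §3.2 (def-R)] -/
@[simp] theorem crossLin_coe (A v : su2) : ((crossLin A v : su2) : ℍ) = ((A : ℍ) * v).im := rfl

/-- (def-R) `R_{A⃗} v⃗ := δA₀ v⃗ + A⃗ × v⃗` with `δ = 1` (the regime of §3–§4: «By Theorem (configurations-theorem), we could set
`δ = 1`»), `A₀ = √(1 − |A⃗|²)`. [cite: DybalskiStottmeisterTanimoto2024, §3.2 (def-R)] -/
def R (A : su2) : su2 →ₗ[ℝ] su2 := A0 A • LinearMap.id + crossLin A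

/-- (R-star) `R_{A⃗}^* v⃗ := δA₀ v⃗ − A⃗ × v⃗`. [cite: DybalskiStottmeisterTanimoto2024, §3.2 (R-star)] -/
def Rstar (A : su2) : su2 →ₗ[ℝ] su2 := A0 A • LinearMap.id - crossLin A

/-- `R_{A⃗} v⃗ = A₀ v⃗ + A⃗ × v⃗`. [cite: DybalskiStottmeisterTanimoto2024, §3.2 (def-R)] -/
theorem R_apply (A v : su2) : R A v = A0 A • v + crossLin A v := rfl

/-- `R_{A⃗}^* v⃗ = A₀ v⃗ − A⃗ × v⃗`. [cite: DybalskiStottmeisterTanimoto2024, §3.2 (R-star)] -/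
theorem Rstar_apply (A v : su2) : Rstar A v = A0 A • v - crossLin A v := rfl

/-- `R_{A⃗} v⃗` as a quaternion: `A₀ v + Im(A v)`. [cite: DybalskiStottmeisterTanimoto2024, §3.2 (def-R)] -/
theorem R_coe (A v : su2) : ((R A v : su2) : ℍ) = A0 A • (v : ℍ) + ((A : ℍ) * v).im := rfl

/-- `R_{A⃗}^* v⃗` as a quaternion: `A₀ v − Im(A v)`. [cite: DybalskiStottmeisterTanimoto2024, §3.2 (R-star)] -/
theorem Rstar_coe (A v : su2) : ((Rstar A v : su2) : ℍ) = A0 A • (v : ℍ) - ((A : ℍ) * v).im := rfl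

/-- «Using `w⃗·(A⃗ × v⃗) = −(A⃗ × w⃗)·v⃗`»: the cross product is skew for the Euclidean scalar product.
[cite: DybalskiStottmeisterTanimoto2024, §3.2 (R-star), derivation] -/
theorem inner_crossLin_left (A v w : su2) : ⟪crossLin A v, w⟫ = -⟪v, crossLin A w⟫ := by
  rw [Submodule.coe_inner, Submodule.coe_inner, crossLin_coe, crossLin_coe, Quaternion.inner_def, Quaternion.inner_def]
  have hA := su2.re_coe A
  have hv := su2.re_coe v
  have hw := su2.re_coe w
  simp only [Quaternion.re_mul, Quaternion.re_star, Quaternion.imI_star, Quaternion.imJ_star, Quaternion.imK_star,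
    Quaternion.re_im, Quaternion.imI_im, Quaternion.imJ_im, Quaternion.imK_im, Quaternion.imI_mul, Quaternion.imJ_mul,
    Quaternion.imK_mul, hA, hv, hw]
  ring

/-- (R-star) «we easily obtain that `R_{A⃗}^*(x)v⃗ = δA₀(x)v⃗ − A⃗(x) × v⃗`»: `⟨R v, w⟩ = ⟨v, R* w⟩`, i.e. `Rstar A` is the adjoint of
`R A` for the scalar product of `ℝ³ = Im ℍ`. [cite: DybalskiStottmeisterTanimoto2024, §3.2 (R-star)] -/
theorem inner_R_left (A v w : su2) : ⟪R A v, w⟫ = ⟪v, Rstar A w⟫ := by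
  rw [Submodule.coe_inner, Submodule.coe_inner, R_coe, Rstar_coe, Quaternion.inner_def, Quaternion.inner_def]
  have hA := su2.re_coe A
  have hv := su2.re_coe v
  have hw := su2.re_coe w
  simp only [Quaternion.re_mul, Quaternion.re_star, Quaternion.imI_star, Quaternion.imJ_star, Quaternion.imK_star,
    Quaternion.re_im, Quaternion.imI_im, Quaternion.imJ_im, Quaternion.imK_im, Quaternion.imI_mul, Quaternion.imJ_mul,
    Quaternion.imK_mul, Quaternion.re_add, Quaternion.imI_add, Quaternion.imJ_add, Quaternion.imK_add, Quaternion.re_sub,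
    Quaternion.imI_sub, Quaternion.imJ_sub, Quaternion.imK_sub, Quaternion.re_smul, Quaternion.imI_smul, Quaternion.imJ_smul,
    Quaternion.imK_smul, smul_eq_mul, hA, hv, hw]
  ring

/-- `Rstar A` is the adjoint of `R A` (Mathlib's `LinearMap.adjoint` on the finite-dimensional inner product space `Im ℍ`).
[cite: DybalskiStottmeisterTanimoto2024, §3.2 (R-star)] -/
theorem Rstar_eq_adjoint (A : su2) : Rstar A = LinearMap.adjoint (R A) := by
  rw [LinearMap.eq_adjoint_iff]
  intro v w
  rw [real_inner_comm w (Rstar A v), ← inner_R_left A w v, real_inner_comm]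

/-- `A⃗ × (A⃗ × (A⃗ × v⃗)) = −|A⃗|² A⃗ × v⃗` (`[A⃗×]³ = −|A⃗|²[A⃗×]`, the identity behind the inverse formula).
[cite: DybalskiStottmeisterTanimoto2024, §3.2 (3.1′) (formula for `R̄_{A⃗}`), derivation] -/
theorem crossLin_crossLin_crossLin (A v : su2) :
    crossLin A (crossLin A (crossLin A v)) = -(‖A‖ ^ 2) • crossLin A v := by
  apply Subtype.ext
  rw [Submodule.coe_smul, crossLin_coe, crossLin_coe, crossLin_coe, norm_sq_su2]
  have hA := su2.re_coe A
  have hv := su2.re_coe v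
  ext <;> simp only [Quaternion.re_im, Quaternion.imI_im, Quaternion.imJ_im, Quaternion.imK_im,
    Quaternion.imI_mul, Quaternion.imJ_mul, Quaternion.imK_mul, Quaternion.re_smul, Quaternion.imI_smul,
    Quaternion.imJ_smul, Quaternion.imK_smul, smul_eq_mul, hA, hv] <;> ring

/-- `A₀² = 1 − |A⃗|²` when `A₀ ≠ 0` (then `|A⃗| < 1`). [cite: DybalskiStottmeisterTanimoto2024, §1.1 («`A₀(x) := √(1 − |A⃗(x)|²)`»); §3.2 («which exist for `A₀ ≠ 0`»)] -/
theorem A0_sq (A : su2) (h : A0 A ≠ 0) : A0 A ^ 2 = 1 - ‖A‖ ^ 2 := by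
  unfold A0 at h ⊢
  have : ¬ (1 - ‖A‖ ^ 2 ≤ 0) := fun h' => h (Real.sqrt_eq_zero'.mpr h')
  exact Real.sq_sqrt (le_of_lt (not_le.mp this))

/-- The polynomial `S_{A⃗} := 1 − A₀[A⃗×] + [A⃗×]²` with `R_{A⃗} S_{A⃗} = S_{A⃗} R_{A⃗} = A₀·1` (so `R̄ = A₀⁻¹ S`).
[cite: DybalskiStottmeisterTanimoto2024, §3.2 (3.1′) (formula for `R̄_{A⃗}`), derivation] -/
def Spoly (A : su2) : su2 →ₗ[ℝ] su2 := LinearMap.id - A0 A • crossLin A + (crossLin A).comp (crossLin A)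

/-- `S v = v − A₀ A⃗×v + A⃗×(A⃗×v)`. [cite: DybalskiStottmeisterTanimoto2024, §3.2 (3.1′)] -/
theorem Spoly_apply (A v : su2) : Spoly A v = v - A0 A • crossLin A v + crossLin A (crossLin A v) := rfl

/-- `R_{A⃗}(S_{A⃗} v) = A₀ v`. [cite: DybalskiStottmeisterTanimoto2024, §3.2 (3.1′), derivation] -/
theorem R_Spoly (A : su2) (h : A0 A ≠ 0) (v : su2) : R A (Spoly A v) = A0 A • v := by
  have hn : ‖A‖ ^ 2 = 1 - A0 A * A0 A := by rw [← sq, A0_sq A h]; ring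
  simp only [Spoly_apply, R_apply, map_add, map_sub, map_smul, crossLin_crossLin_crossLin, hn]
  module

/-- `S_{A⃗}(R_{A⃗} v) = A₀ v`. [cite: DybalskiStottmeisterTanimoto2024, §3.2 (3.1′), derivation] -/
theorem Spoly_R (A : su2) (h : A0 A ≠ 0) (v : su2) : Spoly A (R A v) = A0 A • v := by
  have hn : ‖A‖ ^ 2 = 1 - A0 A * A0 A := by rw [← sq, A0_sq A h]; ring
  simp only [R_apply, Spoly_apply, map_add, map_smul, crossLin_crossLin_crossLin, hn]
  module

/-- (3.1′) `R̄_{A⃗} := A₀⁻¹ (1 − A₀[A⃗×] + [A⃗×]²)` — the printed `R̄_{A⃗}v⃗ = (1/cos a)P_n̂v⃗ + cos a P_n̂^⊥v⃗ − sin a (n̂ × P_n̂^⊥v⃗)`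
(`A₀ = cos a`, `A⃗ = sin a n̂`) with the projections expanded: `[A⃗×]² = sin²a (P_n̂ − 1)`.
[cite: DybalskiStottmeisterTanimoto2024, §3.2 (3.1′) («denote their inverses, which exist for `A₀ ≠ 0`, by `R̄_{A⃗}(x)`»)] -/
def Rbar (A : su2) : su2 →ₗ[ℝ] su2 := (A0 A)⁻¹ • Spoly A

/-- `R R̄ = 1` for `A₀ ≠ 0`. [cite: DybalskiStottmeisterTanimoto2024, §3.2 («their inverses, which exist for `A₀ ≠ 0`»)] -/
theorem R_Rbar (A : su2) (h : A0 A ≠ 0) (v : su2) : R A (Rbar A v) = v := by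
  rw [Rbar, LinearMap.smul_apply, map_smul, R_Spoly A h, smul_smul, inv_mul_cancel₀ h, one_smul]

/-- `R̄ R = 1` for `A₀ ≠ 0`. [cite: DybalskiStottmeisterTanimoto2024, §3.2 («their inverses, which exist for `A₀ ≠ 0`»)] -/
theorem Rbar_R (A : su2) (h : A0 A ≠ 0) (v : su2) : Rbar A (R A v) = v := by
  rw [Rbar, LinearMap.smul_apply, Spoly_R A h, smul_smul, inv_mul_cancel₀ h, one_smul]

/-- `R_{A⃗}` as a linear automorphism of `ℝ³` for `A₀ ≠ 0` («invertible transformations on `ℝ³`», the input of Lemma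
(kernel-lemma)). [cite: DybalskiStottmeisterTanimoto2024, §3.2 («which exist for `A₀ ≠ 0`»), Lemma (kernel-lemma)] -/
def Requiv (A : su2) (h : A0 A ≠ 0) : su2 ≃ₗ[ℝ] su2 :=
  { R A with
    invFun := Rbar A
    left_inv := Rbar_R A h
    right_inv := R_Rbar A h }

/-- `Requiv A h` acts as `R A`. [cite: DybalskiStottmeisterTanimoto2024, §3.2 (def-R)] -/
@[simp] theorem Requiv_apply (A : su2) (h : A0 A ≠ 0) (v : su2) : Requiv A h v = R A v := rfl

/-- `(Requiv A h)⁻¹` acts as `R̄ A`. [cite: DybalskiStottmeisterTanimoto2024, §3.2 (3.1′)] -/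
@[simp] theorem Requiv_symm_apply (A : su2) (h : A0 A ≠ 0) (v : su2) : (Requiv A h).symm v = Rbar A v := rfl

/-! ## (tangent-equation)–(3.3): `XU′ + U′*X = 2(A₀X⃗ + A⃗ × X⃗)·σ⃗` in quaternion form -/

/-- `Im(ξ q) = −(Re q · X⃗ + A⃗ × X⃗)` for an imaginary `ξ` (`X⃗ = vecOf ξ`, `A⃗ = vecOf q`): the computation (3.3)
«`X_j(σ_j(A₀ + iA_kσ_k) + h.c.) = … = 2(A₀X_j − A_kX_{j′}ε_{j′kj})σ_j`» before summing over the block.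
[cite: DybalskiStottmeisterTanimoto2024, §3.2 proof of Theorem (tangent-space-thm), (3.3)] -/
theorem im_coe_mul (ξ : su2) (q : ℍ) :
    ((ξ : ℍ) * q).im = -(q.re • (vecOf (ξ : ℍ) : ℍ) + ((vecOf q : ℍ) * (vecOf (ξ : ℍ) : ℍ)).im) := by
  have hξ := su2.re_coe ξ
  rw [vecOf_coe, vecOf_coe]
  ext <;> simp only [Quaternion.re_im, Quaternion.imI_im, Quaternion.imJ_im, Quaternion.imK_im,
    Quaternion.imI_mul, Quaternion.imJ_mul, Quaternion.imK_mul, Quaternion.re_neg, Quaternion.imI_neg, Quaternion.imJ_neg,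
    Quaternion.imK_neg, Quaternion.re_add, Quaternion.imI_add, Quaternion.imJ_add, Quaternion.imK_add, Quaternion.re_smul,
    Quaternion.imI_smul, Quaternion.imJ_smul, Quaternion.imK_smul, smul_eq_mul, hξ] <;> ring

/-- `δA₀ = Re U′`, and `δ = 1` means `A₀(A⃗) = Re q`. [cite: DybalskiStottmeisterTanimoto2024, §1.1 (Pauli-matrices-decomposition); §3.2 («we could set `δ = 1`»)] -/
theorem A0_vecOf_eq_re (q : SU2) (hq : 0 ≤ q.val.re) : A0 (vecOf q.val) = q.val.re := by
  rw [← abs_re_eq_A0, abs_of_nonneg hq]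

/-- (3.3) in quaternion form at one site with `δ = 1`: `Im(ξ q) = −R_{A⃗} X⃗` (`A⃗ = vecOf q`, `X⃗ = vecOf ξ`).
[cite: DybalskiStottmeisterTanimoto2024, §3.2 proof of Theorem (tangent-space-thm), (3.3)] -/
theorem im_coe_mul_eq_neg_R (ξ : su2) (q : SU2) (hq : 0 ≤ q.val.re) :
    ((ξ : ℍ) * q.val).im = -((R (vecOf q.val) (vecOf (ξ : ℍ)) : su2) : ℍ) := by
  rw [R_coe, A0_vecOf_eq_re q hq, im_coe_mul]

/-- (tangent-equation)/(3.3): `ξq + q*ξ = 2 Im(ξq)` for imaginary `ξ` — the print's `i(XU′ + U′*X)` («+ h.c.»), which by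
`im_coe_mul_eq_neg_R` equals `−2 R_{A⃗}X⃗`, i.e. «`XU′ + U′*X = Σ 2(A₀X_j − A_kX_{j′}ε_{j′kj})σ_j`».
[cite: DybalskiStottmeisterTanimoto2024, §3.2 (tangent-equation)–(3.3)] -/
theorem coe_mul_add_star_mul (ξ : su2) (q : ℍ) : (ξ : ℍ) * q + star q * ξ = (2 : ℝ) • ((ξ : ℍ) * q).im := by
  have hξ := su2.re_coe ξ
  ext <;> simp only [Quaternion.re_im, Quaternion.imI_im, Quaternion.imJ_im, Quaternion.imK_im, Quaternion.re_mul,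
    Quaternion.imI_mul, Quaternion.imJ_mul, Quaternion.imK_mul, Quaternion.re_add, Quaternion.imI_add, Quaternion.imJ_add,
    Quaternion.imK_add, Quaternion.re_smul, Quaternion.imI_smul, Quaternion.imJ_smul, Quaternion.imK_smul, smul_eq_mul,
    Quaternion.re_star, Quaternion.imI_star, Quaternion.imJ_star, Quaternion.imK_star, hξ] <;> ring

/-! ## Flows `e^{tX}U` (§3.1 (flow)) and the derivatives of `𝒞₀`, `c′` along them -/

/-- `(e^{tξ}U)(x) = e^{tξ(x)} U(x)` as quaternions. [cite: DybalskiStottmeisterTanimoto2024, §3.1 (flow) («`γ_t(U) = e^{itX}U`»)] -/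
theorem flow_val (X : Site L n₁ → su2) (t : ℝ) (U : Conf L n₁) (x : Site L n₁) :
    (flow X t U x).val = NormedSpace.exp (t • (X x : ℍ)) * (U x).val := by
  show (expSU2 (t • X x)).val * (U x).val = _
  rw [SU2.expSU2_val_eq_exp, Submodule.coe_smul]

/-- The flow commutes with the change of variables `U = U′V`: `(e^{tX}U)′ = e^{tX}U′` (so `𝓛_X` of a function of `U′` may be
computed on `U′`). [cite: DybalskiStottmeisterTanimoto2024, §3.2 Theorem (tangent-space-thm) («`𝓛_X c′(U′)(y)`»); §2.1 («`U(x) = U′(x)V(y_x)`»)] -/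
theorem flow_Uprime (X : Site L n₁ → su2) (t : ℝ) (U : Conf L n₁) (V : CConf n₁) :
    Uprime (flow X t U) V = flow X t (Uprime U V) := by
  funext x
  simp only [Uprime, flow, mul_assoc]

/-- (vector-fields) «`d/dt γ_t(x) = X(γ_t(x))`»: `d/dt (e^{tξ}q) = ξ e^{tξ} q`.
[cite: DybalskiStottmeisterTanimoto2024, §3.1 (vector-fields), (flow)] -/
theorem hasDerivAt_flow_val (X : Site L n₁ → su2) (U : Conf L n₁) (x : Site L n₁) (t : ℝ) :
    HasDerivAt (fun s : ℝ => (flow X s U x).val) ((X x : ℍ) * (flow X t U x).val) t := by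
  have e : (fun s : ℝ => (flow X s U x).val) = fun s : ℝ => NormedSpace.exp (s • (X x : ℍ)) * (U x).val :=
    funext fun s => flow_val X s U x
  rw [e, flow_val, ← mul_assoc]
  exact (hasDerivAt_exp_smul_const' (X x : ℍ) t).mul_const (U x).val

/-- `d/dt 𝒞₀(e^{tX}U)(y) = L⁻² Σ_{x∈B(y)} ξ(x)(e^{tX}U)(x)`. [cite: DybalskiStottmeisterTanimoto2024, §3.2 proof of Theorem (tangent-space-thm) («Using (vectors), (intermediate-constraint), we compute»)] -/
theorem hasDerivAt_C0_flow (X : Site L n₁ → su2) (U : Conf L n₁) (y : CSite n₁) (t : ℝ) :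
    HasDerivAt (fun s : ℝ => C0 (flow X s U) y) (((L : ℝ) ^ 2)⁻¹ • ∑ x ∈ box L y, (X x : ℍ) * (flow X t U x).val) t := by
  unfold C0
  exact (HasDerivAt.fun_sum fun x _ => hasDerivAt_flow_val X U x t).fun_const_smul _

/-- `c′ = 2 Im Σ_{x∈B(y)} U′(x)` («`c′(U′)(y) := 2i Im 𝒞₀(U′)(y)`» without the `L⁻²`). [cite: DybalskiStottmeisterTanimoto2024, §2.1 (2.2)–(2.3)] -/
theorem cPrime_eq_two_smul_im (U' : Conf L n₁) (y : CSite n₁) :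
    cPrime U' y = (2 : ℝ) • (∑ x ∈ box L y, (U' x).val).im := by
  rw [cPrime_eq, Submodule.coe_sum, SU2.im_sum, Finset.smul_sum, Finset.smul_sum]
  refine Finset.sum_congr rfl fun x _ => ?_
  rw [vecOf_coe, smul_neg, ← neg_smul, neg_neg]

/-- (tangent-equation) «`𝓛_X c′(U′)(y) = i Σ_{x∈B(y)} (X(x)U′(x) + U′(x)*X(x))`»: the derivative of `t ↦ c′(e^{tX}U′)(y)` at
`t = 0` is `Σ_{x∈B(y)} (ξ(x)U′(x) + U′(x)*ξ(x))`. [cite: DybalskiStottmeisterTanimoto2024, §3.2 (tangent-equation)] -/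
theorem hasDerivAt_cPrime_flow (X : Site L n₁ → su2) (U' : Conf L n₁) (y : CSite n₁) :
    HasDerivAt (fun t : ℝ => cPrime (flow X t U') y) (∑ x ∈ box L y, ((X x : ℍ) * (U' x).val + star (U' x).val * (X x : ℍ))) 0 := by
  have e : (fun t : ℝ => cPrime (flow X t U') y) = fun t : ℝ => (2 : ℝ) • imL (∑ x ∈ box L y, (flow X t U' x).val) :=
    funext fun t => by rw [cPrime_eq_two_smul_im, imL_apply]
  rw [e]
  have h1 : HasDerivAt (fun t : ℝ => ∑ x ∈ box L y, (flow X t U' x).val) (∑ x ∈ box L y, (X x : ℍ) * (U' x).val) 0 := by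
    have := HasDerivAt.fun_sum fun x (_ : x ∈ box L y) => hasDerivAt_flow_val X U' x 0
    simpa only [flow_zero] using this
  have h2 : HasDerivAt (fun t : ℝ => (2 : ℝ) • imL (∑ x ∈ box L y, (flow X t U' x).val))
      ((2 : ℝ) • imL (∑ x ∈ box L y, (X x : ℍ) * (U' x).val)) 0 :=
    (imL.hasFDerivAt.comp_hasDerivAt (0 : ℝ) h1).fun_const_smul (2 : ℝ)
  convert h2 using 1
  rw [imL_apply, SU2.im_sum, Finset.smul_sum]
  exact Finset.sum_congr rfl fun x _ => coe_mul_add_star_mul (X x) (U' x).val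

/-- (Lie-derivative)/(tangent-equation): `𝓛_X c′(·)(y)` at `U′` equals `Σ_{x∈B(y)} (ξ(x)U′(x) + U′(x)*ξ(x))`.
[cite: DybalskiStottmeisterTanimoto2024, §3.1 (Lie-derivative); §3.2 (tangent-equation)] -/
theorem lieDeriv_cPrime (X : Site L n₁ → su2) (U' : Conf L n₁) (y : CSite n₁) :
    lieDeriv X (fun W : Conf L n₁ => cPrime W y) U' = ∑ x ∈ box L y, ((X x : ℍ) * (U' x).val + star (U' x).val * (X x : ℍ)) :=
  (hasDerivAt_cPrime_flow X U' y).deriv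

/-- (3.3) summed over the block, `δ = 1` at every site: `Σ_{x∈B(y)} (ξU′ + U′*ξ) = −2 Σ_{x∈B(y)} R(x)X⃗(x)` (as imaginary
quaternions). [cite: DybalskiStottmeisterTanimoto2024, §3.2 proof of Theorem (tangent-space-thm), (3.3)–(3.1)] -/
theorem sum_tangent_eq (X : Site L n₁ → su2) (U' : Conf L n₁) (y : CSite n₁) (hδ : ∀ x ∈ box L y, 0 ≤ (U' x).val.re) :
    ∑ x ∈ box L y, ((X x : ℍ) * (U' x).val + star (U' x).val * (X x : ℍ)) =
      (-2 : ℝ) • ((∑ x ∈ box L y, R (vecOf (U' x).val) (vecOf (X x : ℍ)) : su2) : ℍ) := by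
  rw [Submodule.coe_sum, Finset.smul_sum]
  refine Finset.sum_congr rfl fun x hx => ?_
  rw [coe_mul_add_star_mul, im_coe_mul_eq_neg_R (X x) (U' x) (hδ x hx), smul_neg, ← neg_smul]

/-- In the regime `4c_{1/2}Lε ≤ 1` one has `ε ≤ 1/(4L)` (since `c_{1/2} ≥ 1`), the hypothesis of the §2.2 lemmas.
[cite: DybalskiStottmeisterTanimoto2024, §2.2 Theorem (configurations-theorem) («The second implication requires `4c_{1/2}Lε ≤ 1`»)] -/
theorem eps_le_of_regime (hL : 0 < L) {ε : ℝ} (hε : 0 ≤ ε) (h1 : 4 * ch * L * ε ≤ 1) : ε ≤ 1 / (4 * L) := by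
  have hLr : (0 : ℝ) < L := by exact_mod_cast hL
  rw [le_div_iff₀ (by positivity)]
  calc ε * (4 * L) = 1 * (4 * L * ε) := by ring
    _ ≤ ch * (4 * L * ε) := mul_le_mul_of_nonneg_right one_le_ch (by positivity)
    _ = 4 * ch * L * ε := by ring
    _ ≤ 1 := h1

/-- `δ = 1` on constrained small-field configurations: `Re U′(x) ≥ 0` at every site.
[cite: DybalskiStottmeisterTanimoto2024, §2.2 Theorem (configurations-theorem) («`s = 1`»); §3.2 («we could set `δ = 1`»)] -/
theorem re_Uprime_nonneg (hL : 0 < L) {ε : ℝ} (hε : 0 < ε) (h1 : 4 * ch * L * ε ≤ 1) {U : Conf L n₁}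
    (hU : U ∈ smallField ε) {V : CConf n₁} (hC : avg U = V) (x : Site L n₁) : 0 ≤ (Uprime U V x).val.re := by
  have h := (vecOf_Uprime_small hL hε h1 hU hC x).2
  unfold sgn at h
  exact le_of_lt (sign_eq_one_iff.mp h)

/-- **Theorem (tangent-space-thm).** «Suppose that `U ∈ 𝔘_ε(Ω)` satisfies the constraint (constraint).  Then for any vector
`iX ∈ 𝔤₀^{⊕n²}` the property `𝓛_X c′(U′)(y) = 0` is equivalent to `Σ_{x∈B(y)} R(x)X⃗(x) = 0`, `y ∈ Ω₁`.»  (`R(x) = R_{A⃗(x)}`,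
`A⃗ = vecOf U′`, `X⃗ = vecOf ξ`; regime `4c_{1/2}Lε ≤ 1` of Theorem (configurations-theorem), where `δ = 1`.)
[cite: DybalskiStottmeisterTanimoto2024, §3.2 Theorem (tangent-space-thm), (3.1)] -/
theorem tangent_space_thm (hL : 0 < L) {ε : ℝ} (hε : 0 < ε) (h1 : 4 * ch * L * ε ≤ 1) {U : Conf L n₁}
    (hU : U ∈ smallField ε) {V : CConf n₁} (hC : avg U = V) (X : Site L n₁ → su2) (y : CSite n₁) :
    lieDeriv X (fun W : Conf L n₁ => cPrime (Uprime W V) y) U = 0 ↔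
      ∑ x ∈ box L y, R (vecOf (Uprime U V x).val) (vecOf (X x : ℍ)) = 0 := by
  have hδ : ∀ x ∈ box L y, 0 ≤ (Uprime U V x).val.re := fun x _ => re_Uprime_nonneg hL hε h1 hU hC x
  have e : lieDeriv X (fun W : Conf L n₁ => cPrime (Uprime W V) y) U = lieDeriv X (fun W : Conf L n₁ => cPrime W y) (Uprime U V) := by
    unfold lieDeriv
    simp only [flow_Uprime]
  rw [e, lieDeriv_cPrime, sum_tangent_eq X (Uprime U V) y hδ, smul_eq_zero, Submodule.coe_eq_zero]
  exact or_iff_right (by norm_num)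

/-! ## (3.2)/(vectors): the intrinsic tangency `𝓛_X 𝒞 = 0` of Theorem 1 is the condition (3.1) -/

/-- The derivative of the polar part `c/|c|` of a curve `c` in `ℍ` through `c(t) = ρv` (`ρ > 0`, `|v| = 1`):
`d/ds (c/|c|) = ρ⁻¹ Im(ċ v*) v` — the linearisation of «`𝒞₀ = 𝒞|𝒞₀|`» (polar decomposition) behind «the second relation in
(2.1) is equivalent to … `Im 𝒞₀(U′) = 0`» at first order. [cite: DybalskiStottmeisterTanimoto2024, §1.1 (averaging-def); §2.1 (2.1)–(2.2); §3.1 (vectors)] -/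
theorem hasDerivAt_normalize {c : ℝ → ℍ} {c' : ℍ} {t : ℝ} (hc : HasDerivAt c c' t) {ρ : ℝ} (hρ : 0 < ρ) {v : ℍ}
    (hv : ‖v‖ = 1) (h0 : c t = (ρ : ℍ) * v) :
    HasDerivAt (fun s => (‖c s‖⁻¹ : ℝ) • c s) ((ρ⁻¹ : ℝ) • ((c' * star v).im * v)) t := by
  have hnorm : ‖c t‖ = ρ := by
    rw [h0, norm_mul, Quaternion.norm_coe, Real.norm_of_nonneg hρ.le, hv, mul_one]
  have hct : ‖c t‖ ≠ 0 := by rw [hnorm]; exact hρ.ne'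
  have h2 : HasDerivAt (fun s => Real.sqrt (‖c s‖ ^ 2)) (2 * ⟪c t, c'⟫ / (2 * Real.sqrt (‖c t‖ ^ 2))) t :=
    hc.norm_sq.sqrt (by positivity)
  have h3 : HasDerivAt (fun s => ‖c s‖) (⟪c t, c'⟫ / ρ) t := by
    have e : (fun s => Real.sqrt (‖c s‖ ^ 2)) = fun s => ‖c s‖ := funext fun s => Real.sqrt_sq (norm_nonneg _)
    rw [e, Real.sqrt_sq (norm_nonneg _), hnorm] at h2
    convert h2 using 1
    rw [mul_div_mul_left _ _ (two_ne_zero' ℝ)]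
  have h4 : HasDerivAt (fun s => ‖c s‖⁻¹) (-(⟪c t, c'⟫ / ρ) / ‖c t‖ ^ 2) t := h3.fun_inv hct
  have h5 : HasDerivAt (fun s => ‖c s‖⁻¹ • c s) (‖c t‖⁻¹ • c' + (-(⟪c t, c'⟫ / ρ) / ‖c t‖ ^ 2) • c t) t :=
    h4.fun_smul hc
  convert h5 using 1
  have hvv : star v * v = 1 := by
    rw [Quaternion.star_mul_self, Quaternion.normSq_eq_norm_mul_self, hv, mul_one, Quaternion.coe_one]
  have hinner : ⟪c t, c'⟫ = ρ * (c' * star v).re := by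
    rw [h0, Quaternion.inner_def, mul_assoc, Quaternion.coe_mul_eq_smul, Quaternion.re_smul, smul_eq_mul]
    congr 1
    rw [← Quaternion.re_star (v * star c'), star_mul, star_star]
  rw [hnorm, hinner, h0]
  set w := c' * star v with hw
  have hc' : c' = w * v := by rw [hw, mul_assoc, hvv, mul_one]
  rw [hc', ← Quaternion.sub_re_self w, sub_mul, smul_sub, Quaternion.coe_mul_eq_smul, Quaternion.coe_mul_eq_smul, smul_smul,
    smul_smul, sub_eq_add_neg, ← neg_smul]
  congr 2
  field_simp

/-- For `x ∈ B(y)`: `U′(x) = U(x)V(y)*`. [cite: DybalskiStottmeisterTanimoto2024, §2.1 («`U(x) = U′(x)V(y_x)`»)] -/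
theorem Uprime_val_of_mem_box {U : Conf L n₁} {V : CConf n₁} {y : CSite n₁} {x : Site L n₁} (hx : x ∈ box L y) :
    (Uprime U V x).val = (U x).val * star (V y).val := by
  rw [mem_box] at hx
  rw [← hx]
  rfl

/-- (vectors) for the constraint `𝒞(U) = V` of Theorem 1: along `e^{tX}U` the polar part `𝒞(e^{tX}U)(y)` has derivative
`(|𝒞₀(U)(y)| L²)⁻¹ · Im(Σ_{x∈B(y)} ξ(x)U′(x)) · V(y)` at `t = 0` (constrained small-field `U`, where `𝒞₀(U′)(y) = |𝒞₀| > 0`).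
[cite: DybalskiStottmeisterTanimoto2024, §3.1 (vectors); §3.2 proof of Theorem (tangent-space-thm)] -/
theorem hasDerivAt_avg_flow (hL : 0 < L) {ε : ℝ} (hε : 0 ≤ ε) (hεL : ε ≤ 1 / (4 * L)) {U : Conf L n₁}
    (hU : U ∈ smallField ε) {V : CConf n₁} (hC : avg U = V) (X : Site L n₁ → su2) (y : CSite n₁) :
    HasDerivAt (fun t : ℝ => (avg (flow X t U) y).val)
      ((‖C0 U y‖⁻¹ * ((L : ℝ) ^ 2)⁻¹ : ℝ) • ((∑ x ∈ box L y, (X x : ℍ) * (Uprime U V x).val).im * (V y).val)) 0 := by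
  have h0 : C0 U y ≠ 0 := C0_ne_zero hL hε hεL hU y
  have hρ : 0 < ‖C0 U y‖ := norm_pos_iff.mpr h0
  have hreal : C0 (Uprime U V) y = ((‖C0 (Uprime U V) y‖ : ℝ) : ℍ) := (constraint_iff_C0_real h0).mp (congrFun hC y)
  have hc := hasDerivAt_C0_flow X U y 0
  rw [flow_zero] at hc
  have hct : (fun s : ℝ => C0 (flow X s U) y) 0 = ((‖C0 U y‖ : ℝ) : ℍ) * (V y).val := by
    show C0 (flow X 0 U) y = _
    rw [flow_zero]
    calc C0 U y = C0 (Uprime U V) y * (V y).val := C0_eq_C0_Uprime_mul U V y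
      _ = ((‖C0 (Uprime U V) y‖ : ℝ) : ℍ) * (V y).val := congrArg (· * (V y).val) hreal
      _ = ((‖C0 U y‖ : ℝ) : ℍ) * (V y).val := by rw [norm_C0_Uprime]
  have hD := hasDerivAt_normalize hc hρ (V y).norm_val hct
  have hev : (fun t : ℝ => (avg (flow X t U) y).val) =ᶠ[nhds 0] fun s => (‖C0 (flow X s U) y‖⁻¹ : ℝ) • C0 (flow X s U) y := by
    have h0' : (fun s : ℝ => C0 (flow X s U) y) 0 ≠ 0 := by simpa only [flow_zero] using h0
    exact (hc.continuousAt.eventually_ne h0').mono fun s hs => avg_val_of_ne_zero hs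
  refine (hD.congr_of_eventuallyEq hev).congr_deriv ?_
  have hS : (∑ x ∈ box L y, (X x : ℍ) * (U x).val) * star (V y).val = ∑ x ∈ box L y, (X x : ℍ) * (Uprime U V x).val := by
    rw [Finset.sum_mul]
    refine Finset.sum_congr rfl fun x hx => ?_
    rw [mul_assoc, Uprime_val_of_mem_box hx]
  rw [smul_mul_assoc, hS, Quaternion.im_smul, smul_mul_assoc, smul_smul]

/-- (3.2)/(vectors) ⇔ «`Im 𝒞₀(U′) = 0`» to first order: `X ∈ T_U M_C` (i.e. `d/dt 𝒞(e^{tX}U)(y)|₀ = 0` for all `y`,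
`DST24Setting.IsTangent`) iff `Im Σ_{x∈B(y)} ξ(x)U′(x) = 0` for all `y`, i.e. iff `𝓛_X c′(U′)(y) = 0` ((tangent-equation)).
[cite: DybalskiStottmeisterTanimoto2024, §3.1 (vectors); §3.2 Theorem (tangent-space-thm), proof] -/
theorem isTangent_iff_im_eq_zero (hL : 0 < L) {ε : ℝ} (hε : 0 ≤ ε) (hεL : ε ≤ 1 / (4 * L)) {U : Conf L n₁}
    (hU : U ∈ smallField ε) {V : CConf n₁} (hC : avg U = V) (X : Site L n₁ → su2) :
    IsTangent X U ↔ ∀ y, (∑ x ∈ box L y, (X x : ℍ) * (Uprime U V x).val).im = 0 := by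
  unfold IsTangent
  refine forall_congr' fun y => ?_
  have hD := hasDerivAt_avg_flow hL hε hεL hU hC X y
  have hLr : (0 : ℝ) < L := by exact_mod_cast hL
  have hρ : 0 < ‖C0 U y‖ := norm_pos_iff.mpr (C0_ne_zero hL hε hεL hU y)
  have hcoef : (‖C0 U y‖⁻¹ * ((L : ℝ) ^ 2)⁻¹ : ℝ) ≠ 0 := by positivity
  constructor
  · intro h
    rcases smul_eq_zero.mp (hD.unique h) with h3 | h3
    · exact absurd h3 hcoef
    · exact (mul_eq_zero.mp h3).resolve_right (SU2.val_ne_zero _)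
  · intro h
    rw [h, zero_mul, smul_zero] at hD
    exact hD

/-- `𝓛_X c′(U′)(y) = 2 Im Σ_{x∈B(y)} ξ(x)U′(x)` links the two previous statements. [cite: DybalskiStottmeisterTanimoto2024, §3.2 (tangent-equation)] -/
theorem lieDeriv_cPrime_eq_two_smul_im (X : Site L n₁ → su2) (U' : Conf L n₁) (y : CSite n₁) :
    lieDeriv X (fun W : Conf L n₁ => cPrime W y) U' = (2 : ℝ) • (∑ x ∈ box L y, (X x : ℍ) * (U' x).val).im := by
  rw [lieDeriv_cPrime, SU2.im_sum, Finset.smul_sum]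
  exact Finset.sum_congr rfl fun x _ => coe_mul_add_star_mul (X x) (U' x).val

/-- §3.1–3.2 combined: the tangent vectors at a constrained small-field `U` («Such `X` can be characterized by the conditions
(vectors)») are exactly the `X` with `𝓛_X c′(U′)(y) = 0` for all `y` (the property decided by Theorem (tangent-space-thm)).
[cite: DybalskiStottmeisterTanimoto2024, §3.1 (vectors); §3.2 Theorem (tangent-space-thm)] -/
theorem isTangent_iff_lieDeriv_cPrime (hL : 0 < L) {ε : ℝ} (hε : 0 ≤ ε) (hεL : ε ≤ 1 / (4 * L)) {U : Conf L n₁}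
    (hU : U ∈ smallField ε) {V : CConf n₁} (hC : avg U = V) (X : Site L n₁ → su2) :
    IsTangent X U ↔ ∀ y, lieDeriv X (fun W : Conf L n₁ => cPrime (Uprime W V) y) U = 0 := by
  rw [isTangent_iff_im_eq_zero hL hε hεL hU hC X]
  refine forall_congr' fun y => ?_
  have e : lieDeriv X (fun W : Conf L n₁ => cPrime (Uprime W V) y) U = lieDeriv X (fun W : Conf L n₁ => cPrime W y) (Uprime U V) := by
    unfold lieDeriv
    simp only [flow_Uprime]
  rw [e, lieDeriv_cPrime_eq_two_smul_im, smul_eq_zero]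
  exact (or_iff_right (by norm_num)).symm

/-- `Im Σ_{x∈B(y)} ξ(x)U′(x) = −Σ_{x∈B(y)} R(x)X⃗(x)` (`δ = 1` on the block). [cite: DybalskiStottmeisterTanimoto2024, §3.2 (3.3)–(3.1)] -/
theorem im_sum_coe_mul (X : Site L n₁ → su2) (U' : Conf L n₁) (y : CSite n₁) (hδ : ∀ x ∈ box L y, 0 ≤ (U' x).val.re) :
    (∑ x ∈ box L y, (X x : ℍ) * (U' x).val).im = -((∑ x ∈ box L y, R (vecOf (U' x).val) (vecOf (X x : ℍ)) : su2) : ℍ) := by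
  rw [SU2.im_sum, Submodule.coe_sum, ← Finset.sum_neg_distrib]
  exact Finset.sum_congr rfl fun x hx => im_coe_mul_eq_neg_R (X x) (U' x) (hδ x hx)

/-- **The tangent space of the constraint manifold of Theorem 1** (Theorem (tangent-space-thm) in the form used by §3.3): for a
constrained small-field `U` (regime `4c_{1/2}Lε ≤ 1`), `X` is tangent (`𝓛_X 𝒞(·)(y) = 0 ∀y`, `DST24Setting.IsTangent`) iff
(3.1) `Σ_{x∈B(y)} R_{A⃗(x)} X⃗(x) = 0` for every `y ∈ Ω₁`. [cite: DybalskiStottmeisterTanimoto2024, §3.2 Theorem (tangent-space-thm), (3.1); §3.1 (vectors)] -/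
theorem isTangent_iff (hL : 0 < L) {ε : ℝ} (hε : 0 < ε) (h1 : 4 * ch * L * ε ≤ 1) {U : Conf L n₁}
    (hU : U ∈ smallField ε) {V : CConf n₁} (hC : avg U = V) (X : Site L n₁ → su2) :
    IsTangent X U ↔ ∀ y, ∑ x ∈ box L y, R (vecOf (Uprime U V x).val) (vecOf (X x : ℍ)) = 0 := by
  rw [isTangent_iff_im_eq_zero hL hε.le (eps_le_of_regime hL hε.le h1) hU hC X]
  refine forall_congr' fun y => ?_
  have hδ : ∀ x ∈ box L y, 0 ≤ (Uprime U V x).val.re := fun x _ => re_Uprime_nonneg hL hε h1 hU hC x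
  rw [im_sum_coe_mul X (Uprime U V) y hδ, neg_eq_zero, Submodule.coe_eq_zero]

/-- `X⃗ = vecOf ξ = −ξ` in `Im ℍ` (the dictionary `iX ↔ ξ`). [cite: DybalskiStottmeisterTanimoto2024, §1.1 (Pauli-matrices-decomposition); §3.1 (flow)] -/
theorem vecOf_coe_su2 (ξ : su2) : vecOf (ξ : ℍ) = -ξ := by
  apply Subtype.ext
  rw [vecOf_coe, Submodule.coe_neg, su2.im_coe]

/-- (3.1) in the flow generators `ξ = X x` themselves (`R` is linear and `X⃗ = −ξ`): `X` is tangent iff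
`Σ_{x∈B(y)} R_{A⃗(x)} ξ(x) = 0` for every `y`. [cite: DybalskiStottmeisterTanimoto2024, §3.2 Theorem (tangent-space-thm), (3.1)] -/
theorem isTangent_iff' (hL : 0 < L) {ε : ℝ} (hε : 0 < ε) (h1 : 4 * ch * L * ε ≤ 1) {U : Conf L n₁}
    (hU : U ∈ smallField ε) {V : CConf n₁} (hC : avg U = V) (X : Site L n₁ → su2) :
    IsTangent X U ↔ ∀ y, ∑ x ∈ box L y, R (vecOf (Uprime U V x).val) (X x) = 0 := by
  rw [isTangent_iff hL hε h1 hU hC X]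
  refine forall_congr' fun y => ?_
  simp only [vecOf_coe_su2, map_neg, Finset.sum_neg_distrib, neg_eq_zero]

end

end Literature.MathematicalPhysics.QuantumFieldTheory.DybalskiStottmeisterTanimoto2024.DST24TangentSpace
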